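/-
Copyright (c) 2026. All rights reserved.
Released under Apache 2.0 license as described in the file LICENSE.
-/
import Summits.ValiantsHypothesis.ValiantsHypothesis.Theorems.IsolationRounds
import HarnessLib

/-!
# Isolation rounds with free edges

A variant of the succinct isolation rounds of S4b (`IsolationRoundStep.exists_round`,
`IsolationRounds.exists_isolating_rounds`, after [cite: FennerGurjarThierauf2016, Section 3]) in
which the relation `G₀` on `Fin r` carries a PARTIAL labelling `lab : Fin r → Fin r → Option M`:
LABELLED edges (`some μ`, read-once: `hlab`) receive the variable weight `w μ`, FREE edges (`none`)
receive weight `0` and are invisible to the oracle.  The price is the hypothesis `hfree`: every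
first index `i` carries AT MOST ONE free edge of `G₀` ("column-sparse free edges").
* §1 `sum_labPat_some_mul`, `labPat_some_apply`: S4b-i's label patterns `labPat` at the partial
  labelling, restricted to `M` through `some`.
* §2 `famPatR`: the hash family of a round = the `M`-restrictions of the label patterns of S3's
  short-cycle family; its members are NON-ZERO of height `≤ 1` (`labPat_walkSum_mem_famPatR`): the
  dart matrix of a cycle has zero row sums (S4a `sum_walkSum_dartMat_row`), so the first index of a
  support entry carries two support entries, at most one of them free (`hfree`), and read-once
  gives the pattern value `± 1` at the label of the other.
* §3 `exists_round_free`: ONE ROUND — the oracle hypothesis is S4b-i's VERBATIM (patterns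
  `M → ℤ`), girth doubling is S4b-i's `girth_nextRel` BY NAME with edge weights
  `labWt lab (fun o => o.elim 0 w)`.
* §4 `exists_rounds_girth_free`, `exists_isolating_rounds_free`: the iteration and the isolated
  survivor, re-using S4b-ii's generic `rounds`, `rounds_le`, `rounds_append`, `exists_adm_rounds`,
  `lexVal_lt_of_not_adm`, `sum_sum_get_mul_eq_lexVal` BY NAME at the label type `Option M`.
Currency: kernel-certified helper for the W4 isolation road (free edges = non-zero constant entries
of a determinantal template, O-L2-19); closes no item; one data def `famPatR`; no facts/doors.
-/

set_option linter.dupNamespace false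

namespace Summit.ValiantsHypothesis.ValiantsHypothesis.Theorems.IsolationRoundsFree

open SimpleGraph Summit.ValiantsHypothesis.ValiantsHypothesis.Theorems.ShortCyclePatterns
  Summit.ValiantsHypothesis.ValiantsHypothesis.Theorems.RelationGraphCycles
  Summit.ValiantsHypothesis.ValiantsHypothesis.Theorems.IsolationRoundStep
  Summit.ValiantsHypothesis.ValiantsHypothesis.Theorems.IsolationRounds

variable {M : Type*} [Fintype M] [DecidableEq M] {r : ℕ}

/-! ### §1 Label patterns of a partial labelling, restricted to `M` -/

/-- Transport to S1's currency for a partial labelling: free edges weigh `0`. [this file] -/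
theorem sum_labPat_some_mul (lab : Fin r → Fin r → Option M) (D : Matrix (Fin r) (Fin r) ℤ)
    (w : M → ℕ) :
    ∑ μ, labPat lab D (some μ) * (w μ : ℤ) = ∑ i, ∑ j, D i j * (((lab i j).elim 0 w : ℕ) : ℤ) := by
  have h := sum_labPat_mul lab D fun o => ((o.elim 0 w : ℕ) : ℤ)
  rw [Fintype.sum_option] at h
  simpa using h

omit [Fintype M] in
/-- A labelling that is read-once on the LABELLED positions of `G₀` loses nothing there: the
pattern of a matrix supported in `G₀` at the label of a labelled support entry is that entry.
[this file] -/
theorem labPat_some_apply {G₀ : Fin r → Fin r → Prop} {lab : Fin r → Fin r → Option M}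
    (hlab : ∀ i j i' j' μ, G₀ i j → G₀ i' j' → lab i j = some μ → lab i' j' = some μ →
      i = i' ∧ j = j')
    {D : Matrix (Fin r) (Fin r) ℤ} (hsupp : ∀ i j, D i j ≠ 0 → G₀ i j) {i j : Fin r} {μ : M}
    (hμ : lab i j = some μ) (hij : D i j ≠ 0) : labPat lab D (some μ) = D i j := by
  have hvan : ∀ i' j', ¬ (i' = i ∧ j' = j) →
      (if lab i' j' = some μ then D i' j' else 0) = 0 := by
    intro i' j' hne
    split_ifs with h
    exacts [Classical.by_contradiction fun hD =>
      hne (hlab i' j' i j μ (hsupp i' j' hD) (hsupp i j hij) h hμ), rfl]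
  unfold labPat
  rw [Finset.sum_eq_single_of_mem i (Finset.mem_univ i)]
  · rw [Finset.sum_eq_single_of_mem j (Finset.mem_univ j)]
    · rw [if_pos hμ]
    · intro j' _ hj'
      exact hvan i j' fun h => hj' h.2
  · intro i' _ hi'
    exact Finset.sum_eq_zero fun j' _ => hvan i' j' fun h => hi' h.1

/-! ### §2 The hash family of a round with free edges -/

/-- The HASH FAMILY of a round with free edges: the `M`-restrictions of the label patterns of S3's
short-cycle family of `relGraph G` at scale `L` that are non-zero with all entries in `{-1, 0, 1}`.
[cite: FennerGurjarThierauf2016, Lemma 3.5] -/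
noncomputable def famPatR (G : Fin r → Fin r → Prop) (lab : Fin r → Fin r → Option M) (L : ℕ) :
    Finset (M → ℤ) :=
  ((shortCycleFamily (relGraph G) dartMat L).image fun D μ => labPat lab D (some μ)).filter
    fun π => π ≠ 0 ∧ ∀ μ, (π μ).natAbs ≤ 1

/-- The hash family of a round has at most `(r + r) ^ 4` members (S3). -/
theorem card_famPatR_le (G : Fin r → Fin r → Prop) (lab : Fin r → Fin r → Option M) (L : ℕ) :
    (famPatR G lab L).card ≤ (r + r) ^ 4 := by
  have h := card_shortCycleFamily_le (relGraph G) dartMat L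
  rw [Fintype.card_sum, Fintype.card_fin] at h
  unfold famPatR
  exact (Finset.card_filter_le _ _).trans (Finset.card_image_le.trans h)

/-- Members of the hash family are non-zero. -/
theorem ne_zero_of_mem_famPatR {G : Fin r → Fin r → Prop} {lab : Fin r → Fin r → Option M}
    {L : ℕ} {π : M → ℤ} (h : π ∈ famPatR G lab L) : π ≠ 0 :=
  (Finset.mem_filter.1 h).2.1

/-- Members of the hash family have entries in `{-1, 0, 1}`. -/
theorem natAbs_le_of_mem_famPatR {G : Fin r → Fin r → Prop} {lab : Fin r → Fin r → Option M}
    {L : ℕ} {π : M → ℤ} (h : π ∈ famPatR G lab L) : ∀ μ, (π μ).natAbs ≤ 1 :=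
  (Finset.mem_filter.1 h).2.2

/-- KEY: under a read-once partial labelling with column-sparse free edges, the restricted label
pattern of every cycle of `relGraph G` (`G ⊆ G₀` of girth `> 2L`) of length `≤ 4L` belongs to the
hash family — in particular it is NON-ZERO: by the zero row sums of the dart matrix of a closed
walk, the first index of a support entry carries a second support entry, and at most one of the
two is free. [this file] -/
theorem labPat_walkSum_mem_famPatR {G₀ G : Fin r → Fin r → Prop} {lab : Fin r → Fin r → Option M}
    (hlab : ∀ i j i' j' μ, G₀ i j → G₀ i' j' → lab i j = some μ → lab i' j' = some μ →
      i = i' ∧ j = j')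
    (hfree : ∀ i j j', G₀ i j → G₀ i j' → lab i j = none → lab i j' = none → j = j')
    (hGG₀ : ∀ i j, G i j → G₀ i j) {L : ℕ}
    (hg : ∀ (u : Fin r ⊕ Fin r) (c : (relGraph G).Walk u u), c.IsCycle → 2 * L < c.length)
    {u : Fin r ⊕ Fin r} {c : (relGraph G).Walk u u} (hc : c.IsCycle) (hl : c.length ≤ 4 * L) :
    (fun μ => labPat lab (walkSum dartMat c) (some μ)) ∈ famPatR G lab L := by
  have hsupp : ∀ i j, walkSum dartMat c i j ≠ 0 → G₀ i j :=
    fun i j h => hGG₀ i j (rel_of_walkSum_dartMat_ne_zero c h)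
  have htrail : c.IsTrail := hc.isCircuit.isTrail
  unfold famPatR
  refine Finset.mem_filter.2 ⟨Finset.mem_image_of_mem _ (walkSum_mem_shortCycleFamily hg hc hl),
    fun h0 => ?_, fun μ => ?_⟩
  · -- a support entry `(i, j)` …
    obtain ⟨i, j, hij⟩ : ∃ i j, walkSum dartMat c i j ≠ 0 := by
      by_contra! h
      exact walkSum_dartMat_ne_zero htrail hc.not_nil (Matrix.ext fun i j => h i j)
    -- … a second support entry `(i, j')` in the same row (zero row sums) …
    obtain ⟨j', hj'ne, hij'⟩ : ∃ j', j' ≠ j ∧ walkSum dartMat c i j' ≠ 0 := by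
      by_contra! h
      have hrow := sum_walkSum_dartMat_row c i
      rw [Finset.sum_eq_single j (fun j' _ hj' => h j' hj')
        (fun hj => absurd (Finset.mem_univ j) hj)] at hrow
      exact hij hrow
    -- … one of them labelled (column-sparse free edges) …
    obtain ⟨j₀, μ, hμ, h₀⟩ : ∃ j₀ μ, lab i j₀ = some μ ∧ walkSum dartMat c i j₀ ≠ 0 := by
      cases hj : lab i j with
      | some μ => exact ⟨j, μ, hj, hij⟩
      | none =>
        cases hj'' : lab i j' with
        | some μ => exact ⟨j', μ, hj'', hij'⟩
        | none => exact absurd (hfree i j' j (hsupp i j' hij') (hsupp i j hij) hj'' hj) hj'ne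
    -- … where the restricted pattern equals the entry (read-once).
    have h2 : labPat lab (walkSum dartMat c) (some μ) = 0 := by simpa using congr_fun h0 μ
    rw [labPat_some_apply hlab hsupp hμ h₀] at h2
    exact h₀ h2
  · show (labPat lab (walkSum dartMat c) (some μ)).natAbs ≤ 1
    by_cases h : ∃ i j, lab i j = some μ ∧ walkSum dartMat c i j ≠ 0
    · obtain ⟨i, j, hμ, hij⟩ := h
      rw [labPat_some_apply hlab hsupp hμ hij]
      exact natAbs_walkSum_dartMat_le htrail i j
    · push Not at h
      rw [labPat_eq_zero h]
      simp

/-! ### §3 One round with free edges -/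

/-- ONE ISOLATION ROUND WITH FREE EDGES.  Let `lab : Fin r → Fin r → Option M` label the
relation `G₀` READ-ONCE on its labelled positions (`hlab`) with COLUMN-SPARSE free positions
(`hfree`), and suppose the ORACLE of S4b-i: every family of at most `(r + r) ^ 4` non-zero
height-`≤ 1` patterns `π : M → ℤ` is answered by GOOD weights `w < 2 ^ ℓ` with
`Σ_μ π μ · w μ ≠ 0` for all members.  Then for every `G ⊆ G₀` whose relation graph has girth
`> 2L` there is a good `w` such that the minimum face of `G` under the edge weights
`labWt lab (fun o => o.elim 0 w)` (free edges weigh `0`) has girth `> 4L`.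
[cite: FennerGurjarThierauf2016, Lemmas 3.2–3.5] (free-edge variant) -/
theorem exists_round_free {G₀ G : Fin r → Fin r → Prop} {lab : Fin r → Fin r → Option M}
    {Good : (M → ℕ) → Prop} {ℓ : ℕ}
    (hlab : ∀ i j i' j' μ, G₀ i j → G₀ i' j' → lab i j = some μ → lab i' j' = some μ →
      i = i' ∧ j = j')
    (hfree : ∀ i j j', G₀ i j → G₀ i j' → lab i j = none → lab i j' = none → j = j')
    (horacle : ∀ S : Finset (M → ℤ), S.card ≤ (r + r) ^ 4 → (∀ π ∈ S, π ≠ 0) →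
      (∀ π ∈ S, ∀ μ, (π μ).natAbs ≤ 1) →
      ∃ w : M → ℕ, Good w ∧ (∀ μ, w μ < 2 ^ ℓ) ∧ ∀ π ∈ S, ∑ μ, π μ * (w μ : ℤ) ≠ 0)
    (hGG₀ : ∀ i j, G i j → G₀ i j) {L : ℕ}
    (hg : ∀ (u : Fin r ⊕ Fin r) (c : (relGraph G).Walk u u), c.IsCycle → 2 * L < c.length) :
    ∃ w : M → ℕ, Good w ∧ (∀ μ, w μ < 2 ^ ℓ) ∧
      ∀ (u : Fin r ⊕ Fin r) (c : (relGraph (nextRel G (labWt lab fun o => o.elim 0 w))).Walk u u),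
        c.IsCycle → 4 * L < c.length := by
  obtain ⟨w, hgood, hlt, hS⟩ := horacle (famPatR G lab L) (card_famPatR_le G lab L)
    (fun π hπ => ne_zero_of_mem_famPatR hπ) (fun π hπ => natAbs_le_of_mem_famPatR hπ)
  refine ⟨w, hgood, hlt, girth_nextRel (labWt lab fun o => o.elim 0 w) fun u c hc hl => ?_⟩
  have key : ∑ μ, labPat lab (walkSum dartMat c) (some μ) * (w μ : ℤ) ≠ 0 :=
    hS _ (labPat_walkSum_mem_famPatR hlab hfree hGG₀ hg hc hl)
  rw [sum_labPat_some_mul] at key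
  simpa only [labWt_apply] using key

/-! ### §4 Rounds with free edges and the isolated survivor -/

/-- `t` oracle rounds with free edges push the girth bound of the admissible graph to `2 · 2 ^ t`;
the round weights are lifts `fun o => o.elim 0 w` of good variable weights. -/
theorem exists_rounds_girth_free {G₀ : Fin r → Fin r → Prop} {lab : Fin r → Fin r → Option M}
    {Good : (M → ℕ) → Prop} {ℓ : ℕ}
    (hlab : ∀ i j i' j' μ, G₀ i j → G₀ i' j' → lab i j = some μ → lab i' j' = some μ →
      i = i' ∧ j = j')
    (hfree : ∀ i j j', G₀ i j → G₀ i j' → lab i j = none → lab i j' = none → j = j')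
    (horacle : ∀ S : Finset (M → ℤ), S.card ≤ (r + r) ^ 4 → (∀ π ∈ S, π ≠ 0) →
      (∀ π ∈ S, ∀ μ, (π μ).natAbs ≤ 1) →
      ∃ w : M → ℕ, Good w ∧ (∀ μ, w μ < 2 ^ ℓ) ∧ ∀ π ∈ S, ∑ μ, π μ * (w μ : ℤ) ≠ 0) :
    ∀ t : ℕ, ∃ ws : List (Option M → ℕ), ws.length = t ∧
      (∀ w' ∈ ws, ∃ w : M → ℕ, Good w ∧ (∀ μ, w μ < 2 ^ ℓ) ∧ w' = fun o => o.elim 0 w) ∧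
      ∀ (u : Fin r ⊕ Fin r) (c : (relGraph (rounds lab G₀ ws)).Walk u u), c.IsCycle →
        2 * 2 ^ t < c.length
  | 0 => ⟨[], rfl, fun _ hw => absurd hw List.not_mem_nil, fun u c hc => by
      have h3 := hc.three_le_length
      rw [pow_zero, mul_one]
      omega⟩
  | t + 1 => by
    obtain ⟨ws, hlen, hws, hg⟩ := exists_rounds_girth_free hlab hfree horacle t
    have hGG₀ : ∀ i j, rounds lab G₀ ws i j → G₀ i j := fun i j h => rounds_le lab ws h
    obtain ⟨w, hgood, hlt, hg'⟩ := exists_round_free hlab hfree horacle hGG₀ hg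
    refine ⟨ws ++ [fun o => o.elim 0 w],
      by rw [List.length_append, List.length_singleton, hlen], fun w' hw' => ?_, ?_⟩
    · rw [List.mem_append, List.mem_singleton] at hw'
      rcases hw' with hw' | rfl
      · exact hws w' hw'
      · exact ⟨w, hgood, hlt, rfl⟩
    · rw [rounds_append]
      intro u c hc
      have h := hg' u c hc
      rw [pow_succ]
      omega

omit [Fintype M] [DecidableEq M] in
/-- A lifted weight is bounded by the bound of the variable weights. -/
theorem elim_lt_two_pow {ℓ : ℕ} (w : M → ℕ) (h : ∀ μ, w μ < 2 ^ ℓ) (o : Option M) :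
    o.elim 0 w < 2 ^ ℓ := by
  cases o with
  | none => exact Nat.two_pow_pos ℓ
  | some μ => exact h μ

/-- SUCCINCT ISOLATION ROUNDS WITH FREE EDGES (free-edge variant of the abstract form of
[cite: FennerGurjarThierauf2016, Section 3], cf. S4b-ii `exists_isolating_rounds`).
Let `lab : Fin r → Fin r → Option M` be a partial labelling of the relation `G₀` on `Fin r`,
READ-ONCE on its labelled positions (`hlab`) and with COLUMN-SPARSE free positions (`hfree`: each
first index carries at most one free position of `G₀`), and suppose an ORACLE answers every
family of at most `(r + r) ^ 4` non-zero height-`≤ 1` patterns `π : M → ℤ` with GOOD weights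
`w < 2 ^ ℓ` such that `Σ_μ π μ · w μ ≠ 0` for all members.  If `G₀` is admissible at all, then
there are `T ≤ log₂ r + 1` good weight vectors `w_t < 2 ^ ℓ` and a `G₀`-admissible `σ` such that
for every `B` with `r · 2 ^ ℓ ≤ 2 ^ B` the combined weight `W μ = Σ_t w_t μ · 2 ^ (B (T-1-t))`,
charged on LABELLED positions only (free positions weigh `0`), gives `σ` strictly smaller weight
than every other `G₀`-admissible permutation. -/
theorem exists_isolating_rounds_free {G₀ : Fin r → Fin r → Prop} {lab : Fin r → Fin r → Option M}
    {Good : (M → ℕ) → Prop} {ℓ : ℕ}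
    (hlab : ∀ i j i' j' μ, G₀ i j → G₀ i' j' → lab i j = some μ → lab i' j' = some μ →
      i = i' ∧ j = j')
    (hfree : ∀ i j j', G₀ i j → G₀ i j' → lab i j = none → lab i j' = none → j = j')
    (horacle : ∀ S : Finset (M → ℤ), S.card ≤ (r + r) ^ 4 → (∀ π ∈ S, π ≠ 0) →
      (∀ π ∈ S, ∀ μ, (π μ).natAbs ≤ 1) →
      ∃ w : M → ℕ, Good w ∧ (∀ μ, w μ < 2 ^ ℓ) ∧ ∀ π ∈ S, ∑ μ, π μ * (w μ : ℤ) ≠ 0)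
    (hadm : ∃ σ : Equiv.Perm (Fin r), ∀ k, G₀ k (σ k)) :
    ∃ (T : ℕ) (ws : Fin T → M → ℕ), T ≤ Nat.log 2 r + 1 ∧ (∀ t, Good (ws t)) ∧
      (∀ t μ, ws t μ < 2 ^ ℓ) ∧ ∃ σ : Equiv.Perm (Fin r), (∀ k, G₀ k (σ k)) ∧
        ∀ B : ℕ, r * 2 ^ ℓ ≤ 2 ^ B → ∀ τ : Equiv.Perm (Fin r), (∀ k, G₀ k (τ k)) → τ ≠ σ →
          ∑ k, ∑ t, (lab k (σ k)).elim 0 (ws t) * 2 ^ (B * (T - 1 - ↑t)) <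
            ∑ k, ∑ t, (lab k (τ k)).elim 0 (ws t) * 2 ^ (B * (T - 1 - ↑t)) := by
  obtain ⟨ws, hlen, hws, hg⟩ := exists_rounds_girth_free hlab hfree horacle (Nat.log 2 r + 1)
  -- after `log₂ r + 1` rounds the admissible graph is acyclic: at most one survivor
  have hnoc : ∀ (u : Fin r ⊕ Fin r) (c : (relGraph (rounds lab G₀ ws)).Walk u u),
      ¬ c.IsCycle := by
    intro u c hc
    have h1 := hg u c hc
    have h2 := length_le_card_of_isCycle hc
    rw [Fintype.card_sum, Fintype.card_fin] at h2
    have h3 : r < 2 ^ (Nat.log 2 r + 1) := Nat.lt_pow_succ_log_self (by decide) r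
    omega
  obtain ⟨σ₀, hσ₀⟩ := hadm
  obtain ⟨σ, hσ⟩ := exists_adm_rounds lab ws hσ₀
  have hws' : ∀ t : Fin ws.length, ∃ w : M → ℕ, Good w ∧ (∀ μ, w μ < 2 ^ ℓ) ∧
      ws.get t = fun o => o.elim 0 w := fun t => hws _ (List.get_mem ws t)
  choose wv hgood hlt hwv using hws'
  refine ⟨ws.length, wv, hlen.le, hgood, hlt, σ, fun k => rounds_le lab ws (hσ k),
    fun B hB τ hτ hne => ?_⟩
  have hτn : ¬ ∀ k, rounds lab G₀ ws k (τ k) := fun hτ' =>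
    hne (perm_unique_of_forall_not_isCycle _ hnoc hτ' hσ)
  -- digits are carry-free: each round weight of `σ` is `< r · 2 ^ ℓ ≤ 2 ^ B`
  have hdig : ∀ w' ∈ ws, ∑ k, w' (lab k (σ k)) < 2 ^ B := by
    intro w' hw'
    obtain ⟨w, -, hwlt, rfl⟩ := hws w' hw'
    rcases Nat.eq_zero_or_pos r with hr | hr
    · subst hr
      simp only [Finset.univ_eq_empty, Finset.sum_empty]
      exact Nat.two_pow_pos B
    · calc ∑ k, (fun o : Option M => o.elim 0 w) (lab k (σ k)) < ∑ _k : Fin r, 2 ^ ℓ :=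
            Finset.sum_lt_sum_of_nonempty ⟨⟨0, hr⟩, Finset.mem_univ _⟩ fun k _ =>
              elim_lt_two_pow w hwlt (lab k (σ k))
        _ = r * 2 ^ ℓ := by
            rw [Finset.sum_const, Finset.card_univ, Fintype.card_fin, smul_eq_mul]
        _ ≤ 2 ^ B := hB
  have key := lexVal_lt_of_not_adm lab ws hσ hτ hτn hdig
  rw [← sum_sum_get_mul_eq_lexVal lab ws σ B, ← sum_sum_get_mul_eq_lexVal lab ws τ B] at key
  simpa only [hwv] using key

end Summit.ValiantsHypothesis.ValiantsHypothesis.Theorems.IsolationRoundsFree
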